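import Mathlib.Analysis.Calculus.Taylor
import Mathlib.Analysis.Calculus.ContDiff.Bounds
import Mathlib.Analysis.SpecialFunctions.Gaussian.FourierTransform
import Mathlib.MeasureTheory.Measure.Haar.NormedSpace
import HarnessLib

/-!
# Gaussian damping of functions vanishing to finite order along an axis
(Sbierski 2015, §3, first lemma = arXiv:1311.2477, Lemma 4; the integral estimate behind the
Gaussian-beam approximation; namespace `Literature.Analysis.Asymptotics.GaussianBeam`)

In the construction of Gaussian beams `u_λ = a e^{iλφ}` along a null geodesic `γ` (Sbierski,
Anal. PDE 8 (2015), §3; Ralston 1982), the error terms of `□u_λ` are of the form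
`λ^j f(x) e^{iλφ}` with `f` vanishing to some order `S` along `γ` and `|e^{iλφ}| = e^{-λ Im φ}`,
`Im φ ≥ c · dist(x, γ)²`. In slice coordinates `(x₀, x̲)` with `γ = {x̲ = 0}` their size in
`L²(R_{[0,T]})` is governed by the **Gaussian damping lemma** (loc. cit., first lemma of §3):

> Let `f ∈ C^∞_0([0,T] × ℝ³, ℂ)` vanish along `{x₁ = x₂ = x₃ = 0}` to order `S`, i.e., all partial
> derivatives up to and including the order `S` of `f` vanish along `{x₁ = x₂ = x₃ = 0}`. We then
> have `∫_{[0,T]×ℝ³} (|f(x)| e^{-λ(x₁²+x₂²+x₃²)})² dx ≤ C λ^{-(S+1)-3/2}`, where `C` depends on `f`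
> (and on `T`).

with the printed proof: stretched coordinates `y̲ = √λ x̲`, and `|f(x)| ≤ C |x̲|^{S+1}` for
`x ∈ [0,T] × ℝ³` since `f` vanishes along the axis to order `S` and has compact support.

This file **proves** it (`gaussianDamping`, `gaussianDamping_three`), for `f : ℝ × V → E` smooth
with compact support on any finite-dimensional real inner product space `V` (`d = dim V` in place
of `3`: bound `C (√λ)⁻¹^{2(S+1)+d} = C λ^{-(S+1)-d/2}`) with values in a real normed space `E`
(`ℂ` in the source), the hypothesis being that the transversal derivatives `D^k_y f(t,·)(0)`,
`k ≤ S`, vanish for all `t` (equivalent to the vanishing of all partial derivatives of order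
`≤ S` along the axis, the axial ones being derivatives of the identically vanishing restrictions):

* `norm_le_of_iteratedFDeriv_eq_zero` — a `C^{S+1}` function with `‖D^{S+1}F‖ ≤ D` and vanishing
  derivatives of order `≤ S` at `0` satisfies `‖F(y)‖ ≤ D ‖y‖^{S+1}/S!` (Taylor's formula with
  Lagrange-type remainder bound along the ray through `y`, Mathlib's `taylor_mean_remainder_bound`,
  the ray derivatives being `D^nF(tw)(w,…,w)`, `iteratedDeriv_comp_smul`);
* `integral_norm_pow_mul_exp_neg_mul_sq` — the scaling law
  `∫ ‖y‖^{2m} e^{-2λ‖y‖²} dy = (√λ)⁻¹^{2m+d} ∫ ‖z‖^{2m} e^{-2‖z‖²} dz` (Haar measure scaling,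
  `Measure.integral_comp_smul`), the moment integrand being integrable
  (`integrable_norm_pow_mul_exp_neg_two_mul_sq`, dominated by `m! e^{-‖z‖²}` through
  `x^m e^{-x} ≤ m!`);
* `gaussianDamping` — the lemma: `∫_{[0,T]×V} ‖f‖² e^{-2λ‖y‖²} ≤ C (√λ)⁻¹^{2(S+1)+d}` for all
  `λ > 0`, with `C = (D/S!)² · max(T,0) · ∫ ‖z‖^{2(S+1)} e^{-2‖z‖²} dz`, `D = sup ‖D^{S+1} f‖`;
  `gaussianDamping_three` — the printed form on `ℝ × ℝ³` with values in `ℂ`, bound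
  `C λ^{-(S+1)-3/2}`; `gaussianDamping_movingCenter` — the same along a smooth centre curve
  `y = ξ(t)` with weight `e^{-2λc‖y − ξ(t)‖²}`, `c > 0` (the form used for beams centred on
  `γ(s) = (s, ξ(s))` with `Im φ ≥ c · dist(·, γ)²`), by the volume-preserving shear
  `(t, v) ↦ (t, v + ξ(t))` (`measurePreserving_shear`);
* the working forms without regularity hypotheses: `integral_norm_pow_mul_exp_neg_mul_sq'` (the
  scaling law for moments of *every* order `m`, rate `(√λ)⁻¹^{m+d}`),
  `setIntegral_slab_norm_sub_pow_mul_exp` (the slab integral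
  `∫_{[0,T]×V} ‖y − ξ(t)‖^m e^{-2λ‖y − ξ(t)‖²} = max(T,0) (√λ)⁻¹^{m+d} ∫ ‖z‖^m e^{-2‖z‖²}`),
  `setIntegral_slab_le_of_le_norm_sub_pow_mul_exp` (any `F ≤ D ‖y − ξ(t)‖^m e^{-2λ‖y−ξ(t)‖²}` has
  slab integral `≤ D · max(T,0) (√λ)⁻¹^{m+d} ∫ ‖z‖^m e^{-2‖z‖²}`) and `gaussianDamping_of_norm_le`
  (the lemma from the flat bound `‖f(t,y)‖ ≤ D ‖y − ξ(t)‖^{S+1}` alone, which is what the printed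
  proof extracts from the vanishing of the derivatives) — the shapes in which the estimate is
  consumed for the error terms `λ^j dist(·,γ)^m e^{-2λ Im φ}` of `□u_λ` and of the energy density;
* the two consumers in the proof of the second lemma of §3 [arXiv Lemma 5]:
  `setIntegral_slab_sq_le_of_beam_bound` / `exists_slab_sq_le_of_beam_bound` — the **first
  condition** `‖□u_λ‖²_{L²(R_{[0,T]})} ≤ C` from the pointwise WKB bound
  `|□u_λ| ≤ e^{-λc‖y−ξ(t)‖²}(λ² A ‖y−ξ(t)‖³ + λ B ‖y−ξ(t)‖ + D)` (eikonal term vanishing to second,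
  transport term to zeroth order; explicit constant, rate `λ (√λ)⁻¹^d = λ^{-1/2}` for `d = 3`),
  with the integrability of the model moments on slabs (`integrableOn_slab_norm_sub_pow_mul_exp`);
  and `le_setIntegral_ball_exp_neg_mul_sq` — the **scaling lower bound**
  `∫_{B(y₀,δ)} e^{-2λC‖y−y₀‖²} ≥ (√λ)⁻¹^d ∫_{B(0,δ)} e^{-2C‖z‖²}` (`λ ≥ 1`) behind
  `E^N_0(u_λ) ≥ C(λ^{1/2} − 1)` ("only a `λ^{-3/2}` damping").

It is the first machine-checked ingredient of the Gaussian-beam theory of Part I of the paper,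
vendored as the named fact `KerrNullGeodesicGaussianBeams`
(`Literature/Barriers/FinalStateConjecture/TrappingDerivativeLossGeodesicBeams.lean`) behind
Sbierski's Kerr trapping barrier.

## References

* J. Sbierski, *Characterisation of the energy of Gaussian beams on Lorentzian manifolds: with
  applications to black hole spacetimes*, Anal. PDE 8 (2015) 1379–1420 (arXiv:1311.2477v2,
  held): §3, first lemma and its proof [arXiv §2.2, Lemma 4, pp. 10–11 of the held text]
  (key `Sbierski2015`).
* J. Ralston, *Gaussian beams and the propagation of singularities*, in: Studies in partial
  differential equations, MAA Stud. Math. 23 (1982) 206–248 (the method; cited by Sbierski as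
  [Ral83]).
-/

noncomputable section

open Set Filter MeasureTheory Real
open scoped Topology ContDiff

namespace Literature.Analysis.Asymptotics.GaussianBeam

variable {V : Type*} [NormedAddCommGroup V] [InnerProductSpace ℝ V] [FiniteDimensional ℝ V]
  [MeasurableSpace V] [BorelSpace V]
variable {E : Type*} [NormedAddCommGroup E] [NormedSpace ℝ E]

/-! ### Gaussian moments: a pointwise bound and the scaling law -/

/-- `x^m e^{-x} ≤ m!` for `x ≥ 0` (from `x^m / m! ≤ e^x`, the exponential series). [folklore] -/
theorem pow_mul_exp_neg_le_factorial {x : ℝ} (hx : 0 ≤ x) (m : ℕ) :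
    x ^ m * exp (-x) ≤ m.factorial := by
  have h := Real.pow_div_factorial_le_exp x hx m
  have hf : (0 : ℝ) < m.factorial := by exact_mod_cast m.factorial_pos
  rw [div_le_iff₀ hf] at h
  rw [Real.exp_neg, ← div_eq_mul_inv, div_le_iff₀ (Real.exp_pos x)]
  linarith

/-- The Gaussian moment integrand `‖z‖^{2m} e^{-2‖z‖²}` is integrable (dominated by
`m! e^{-‖z‖²}`). [folklore] -/
theorem integrable_norm_pow_mul_exp_neg_two_mul_sq (m : ℕ) :
    Integrable fun z : V ↦ ‖z‖ ^ (2 * m) * exp (-2 * ‖z‖ ^ 2) := by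
  have hg : Integrable fun z : V ↦ (m.factorial : ℝ) * exp (-1 * ‖z‖ ^ 2) := by
    have h := (GaussianFourier.integrable_cexp_neg_mul_sq_norm_add (V := V) (b := 1)
      (by simp) 0 0).norm
    have h' : (fun z : V ↦ ‖Complex.exp (-(1 : ℂ) * ‖z‖ ^ 2 + 0 * (inner ℝ (0 : V) z : ℂ))‖) =
        fun z : V ↦ exp (-1 * ‖z‖ ^ 2) := by
      funext z
      rw [Complex.norm_exp]
      simp [← Complex.ofReal_pow]
    rw [h'] at h
    exact h.const_mul _
  refine hg.mono' (by fun_prop) (Eventually.of_forall fun z ↦ ?_)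
  rw [Real.norm_eq_abs, abs_of_nonneg (by positivity)]
  have h1 : ‖z‖ ^ (2 * m) * exp (-2 * ‖z‖ ^ 2) =
      ((‖z‖ ^ 2) ^ m * exp (-(‖z‖ ^ 2))) * exp (-1 * ‖z‖ ^ 2) := by
    rw [pow_mul, mul_assoc, ← Real.exp_add]; ring_nf
  rw [h1]
  exact mul_le_mul_of_nonneg_right (pow_mul_exp_neg_le_factorial (by positivity) m)
    (Real.exp_pos _).le

/-- **Scaling law of the Gaussian moments**: for `λ > 0`,
`∫ ‖y‖^{2m} e^{-2λ‖y‖²} dy = (√λ)⁻¹^{2m + d} ∫ ‖z‖^{2m} e^{-2‖z‖²} dz`, `d = dim V`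
(substitute `y = z/√λ`: Sbierski's "stretched coordinates `y̲ = √λ x̲`", proof of the first lemma
of §3). [cite: Sbierski2015, §3 (first lemma, proof)] -/
theorem integral_norm_pow_mul_exp_neg_mul_sq (m : ℕ) {lam : ℝ} (hlam : 0 < lam) :
    ∫ y : V, ‖y‖ ^ (2 * m) * exp (-2 * lam * ‖y‖ ^ 2) =
      (√lam)⁻¹ ^ (2 * m + Module.finrank ℝ V) * ∫ z : V, ‖z‖ ^ (2 * m) * exp (-2 * ‖z‖ ^ 2) := by
  set R : ℝ := (√lam)⁻¹ with hR
  have hRpos : 0 < R := by positivity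
  have hR2 : lam * R ^ 2 = 1 := by
    rw [hR, inv_pow, Real.sq_sqrt hlam.le, mul_inv_cancel₀ hlam.ne']
  set G : V → ℝ := fun y ↦ ‖y‖ ^ (2 * m) * exp (-2 * lam * ‖y‖ ^ 2) with hG
  have hcomp : ∀ z : V, G (R • z) = R ^ (2 * m) * (‖z‖ ^ (2 * m) * exp (-2 * ‖z‖ ^ 2)) := by
    intro z
    simp only [hG, norm_smul, Real.norm_eq_abs, abs_of_pos hRpos, mul_pow]
    have : -2 * lam * (R ^ 2 * ‖z‖ ^ 2) = -2 * ‖z‖ ^ 2 := by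
      rw [show -2 * lam * (R ^ 2 * ‖z‖ ^ 2) = -2 * (lam * R ^ 2) * ‖z‖ ^ 2 by ring, hR2]; ring
    rw [this]
    ring
  have hscale := Measure.integral_comp_smul (volume : Measure V) G R
  simp only [hcomp, integral_const_mul] at hscale
  have hRd : |(R ^ Module.finrank ℝ V)⁻¹| = (R ^ Module.finrank ℝ V)⁻¹ :=
    abs_of_pos (by positivity)
  rw [hRd, smul_eq_mul] at hscale
  have hRdpos : 0 < R ^ Module.finrank ℝ V := by positivity
  have key : ∫ y : V, G y = R ^ Module.finrank ℝ V * (R ^ (2 * m) *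
      ∫ z : V, ‖z‖ ^ (2 * m) * exp (-2 * ‖z‖ ^ 2)) := by
    rw [hscale, ← mul_assoc, mul_inv_cancel₀ hRdpos.ne', one_mul]
  show ∫ y : V, G y = _
  rw [key, pow_add]
  ring

/-! ### Functions flat to order `S` at a point are `O(‖y‖^{S+1})` (Taylor along rays) -/

omit [FiniteDimensional ℝ V] [MeasurableSpace V] [BorelSpace V] in
/-- The restriction of `F` to the ray `t ↦ t • w`: its iterated derivatives are the iterated
Fréchet derivatives of `F` on `(w, …, w)` (chain rule for a linear map). [folklore] -/
theorem iteratedDeriv_comp_smul {F : V → E} {N : ℕ∞} (hF : ContDiff ℝ N F) (w : V) {n : ℕ}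
    (hn : (n : ℕ∞) ≤ N) (t : ℝ) :
    iteratedDeriv n (fun r : ℝ ↦ F (r • w)) t = iteratedFDeriv ℝ n F (t • w) fun _ ↦ w := by
  set L : ℝ →L[ℝ] V := (1 : ℝ →L[ℝ] ℝ).smulRight w with hL
  have hfun : (fun r : ℝ ↦ F (r • w)) = F ∘ L := by
    funext r; simp [hL]
  rw [iteratedDeriv_eq_iteratedFDeriv, hfun,
    L.iteratedFDeriv_comp_right (hF.of_le (by exact_mod_cast le_rfl)) t (by exact_mod_cast hn)]
  simp [hL, ContinuousMultilinearMap.compContinuousLinearMap_apply]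

omit [FiniteDimensional ℝ V] [MeasurableSpace V] [BorelSpace V] in
/-- **Flat functions are `O(‖y‖^{S+1})`**: if `F` is `C^{S+1}` with
`‖D^{S+1}F‖ ≤ D` everywhere and all derivatives of order `≤ S` vanish at `0`, then
`‖F(y)‖ ≤ D ‖y‖^{S+1} / S!` (Taylor's formula along the ray through `y`; Sbierski: "since `f`
vanishes along the `x₀` axis to order `S` and has compact support, we get
`|f(x)| ≤ C · |x̲|^{S+1}`"). [cite: Sbierski2015, §3 (first lemma, proof)] -/
theorem norm_le_of_iteratedFDeriv_eq_zero {F : V → E} {S : ℕ} (hF : ContDiff ℝ (S + 1 : ℕ) F)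
    (hvan : ∀ k ≤ S, iteratedFDeriv ℝ k F 0 = 0) {D : ℝ}
    (hD : ∀ y, ‖iteratedFDeriv ℝ (S + 1) F y‖ ≤ D) (y : V) :
    ‖F y‖ ≤ D * ‖y‖ ^ (S + 1) / S.factorial := by
  have hD0 : 0 ≤ D := (norm_nonneg _).trans (hD 0)
  by_cases hy : y = 0
  · subst hy
    have h0 : F 0 = 0 := by
      have := hvan 0 (Nat.zero_le S)
      rw [← norm_eq_zero, ← norm_iteratedFDeriv_zero (𝕜 := ℝ), this, norm_zero]
    simp [h0]
  -- the ray through `y`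
  set r : ℝ := ‖y‖ with hr
  have hrpos : 0 < r := norm_pos_iff.mpr hy
  set w : V := r⁻¹ • y with hw
  have hwnorm : ‖w‖ = 1 := by
    rw [hw, norm_smul, norm_inv, norm_norm, inv_mul_cancel₀ hrpos.ne']
  have hyw : y = r • w := by
    rw [hw, smul_smul, mul_inv_cancel₀ hrpos.ne', one_smul]
  set g : ℝ → E := fun t ↦ F (t • w) with hg
  have hgdiff : ContDiff ℝ (S + 1 : ℕ) g := by
    simp only [hg]
    exact hF.comp ((contDiff_id).smul contDiff_const)
  -- iterated derivatives of `g` along the ray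
  have hgder : ∀ n ≤ S + 1, ∀ t, iteratedDeriv n g t = iteratedFDeriv ℝ n F (t • w) fun _ ↦ w :=
    fun n hn t ↦ iteratedDeriv_comp_smul hF w (by exact_mod_cast hn) t
  have hwithin : ∀ n ≤ S + 1, ∀ t ∈ Icc (0 : ℝ) r,
      iteratedDerivWithin n g (Icc 0 r) t = iteratedDeriv n g t := fun n hn t ht ↦
    iteratedDerivWithin_eq_iteratedDeriv (uniqueDiffOn_Icc hrpos)
      (hgdiff.contDiffAt.of_le (by exact_mod_cast hn)) ht
  -- Taylor's formula with the bound `D` on the `(S+1)`-st derivative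
  have hbound : ∀ t ∈ Icc (0 : ℝ) r, ‖iteratedDerivWithin (S + 1) g (Icc 0 r) t‖ ≤ D := by
    intro t ht
    rw [hwithin (S + 1) le_rfl t ht, hgder (S + 1) le_rfl t]
    refine (ContinuousMultilinearMap.le_opNorm _ _).trans ?_
    simp only [hwnorm, Finset.prod_const_one, mul_one]
    exact hD _
  have htaylor := taylor_mean_remainder_bound hrpos.le hgdiff.contDiffOn
    (right_mem_Icc.mpr hrpos.le) hbound
  -- the Taylor polynomial at `0` vanishes
  have hpoly : taylorWithinEval g S (Icc 0 r) 0 r = 0 := by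
    rw [taylor_within_apply]
    refine Finset.sum_eq_zero fun k hk ↦ ?_
    have hkS : k ≤ S := Nat.lt_succ_iff.mp (Finset.mem_range.mp hk)
    rw [hwithin k (by omega) 0 (left_mem_Icc.mpr hrpos.le), hgder k (by omega) 0, zero_smul,
      hvan k hkS]
    simp
  rw [hpoly, sub_zero, sub_zero] at htaylor
  have hgr : g r = F y := by
    show F (r • w) = F y
    rw [← hyw]
  rw [hgr] at htaylor
  exact htaylor

/-! ### Sbierski's Gaussian damping lemma -/

omit [FiniteDimensional ℝ V] [MeasurableSpace V] [BorelSpace V] in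
/-- Iterated derivatives of a slice `y ↦ f(t, y)` are bounded by those of `f` (chain rule for
the isometric embedding `y ↦ (t, y)`). [folklore] -/
theorem norm_iteratedFDeriv_slice_le {f : ℝ × V → E} {N : ℕ∞} (hf : ContDiff ℝ N f) (t : ℝ)
    {n : ℕ} (hn : (n : ℕ∞) ≤ N) (y : V) :
    ‖iteratedFDeriv ℝ n (fun z : V ↦ f (t, z)) y‖ ≤ ‖iteratedFDeriv ℝ n f (t, y)‖ := by
  set L : V →L[ℝ] ℝ × V := ContinuousLinearMap.inr ℝ ℝ V with hL
  have hfun : (fun z : V ↦ f (t, z)) = (fun w : ℝ × V ↦ f ((t, 0) + w)) ∘ L := by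
    funext z; simp [hL]
  have hf' : ContDiff ℝ N fun w : ℝ × V ↦ f ((t, 0) + w) := hf.comp (contDiff_const.add contDiff_id)
  rw [hfun, L.iteratedFDeriv_comp_right (hf'.of_le (by exact_mod_cast le_rfl)) y
    (by exact_mod_cast hn), iteratedFDeriv_comp_add_left]
  refine (ContinuousMultilinearMap.norm_compContinuousLinearMap_le _ _).trans ?_
  have hL1 : ‖L‖ ≤ 1 := ContinuousLinearMap.norm_inr_le_one ℝ ℝ V
  have hprod : ∏ _i : Fin n, ‖L‖ ≤ 1 := by
    rw [Finset.prod_const, Finset.card_univ, Fintype.card_fin]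
    exact pow_le_one₀ (norm_nonneg L) hL1
  have : (t, (0 : V)) + L y = (t, y) := by simp [hL]
  rw [this]
  exact mul_le_of_le_one_right (norm_nonneg _) hprod

/-- **Sbierski's Gaussian damping lemma** (Anal. PDE 8 (2015), §3, first lemma; arXiv:1311.2477,
Lemma 4): "Let `f ∈ C^∞_0([0,T] × ℝ³, ℂ)` vanish along `{x₁ = x₂ = x₃ = 0}` to order `S`, i.e.,
all partial derivatives up to and including the order `S` of `f` vanish along
`{x₁ = x₂ = x₃ = 0}`. We then have `∫_{[0,T]×ℝ³} (|f(x)| e^{-λ(x₁²+x₂²+x₃²)})² dx ≤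
C λ^{-(S+1)-3/2}`, where `C` depends on `f` (and on `T`)." Proof as printed: `|f(x)| ≤ C|x̲|^{S+1}`
(Taylor, compact support), then the stretched coordinates `y̲ = √λ x̲`. Stated for a smooth
compactly supported `f : ℝ × V → E` on any finite-dimensional real inner product space `V`
(`d = dim V` in place of `3`, the bound being `C (√λ)⁻¹^{2(S+1)+d} = C λ^{-(S+1)-d/2}`) with values
in any real normed space, the vanishing of the transversal derivatives being
`D^k_y f(t, ·)(0) = 0` for `k ≤ S` and all `t`. [cite: Sbierski2015, §3 (first lemma); arXiv:1311.2477 Lemma 4] -/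
theorem gaussianDamping (f : ℝ × V → E) (hf : ContDiff ℝ ∞ f) (hsupp : HasCompactSupport f)
    (S : ℕ) (hvan : ∀ t : ℝ, ∀ k ≤ S, iteratedFDeriv ℝ k (fun y : V ↦ f (t, y)) 0 = 0) (T : ℝ) :
    ∃ C : ℝ, 0 ≤ C ∧ ∀ lam : ℝ, 0 < lam →
      ∫ p in Icc (0 : ℝ) T ×ˢ (univ : Set V), ‖f p‖ ^ 2 * exp (-2 * lam * ‖p.2‖ ^ 2) ≤
        C * (√lam)⁻¹ ^ (2 * (S + 1) + Module.finrank ℝ V) := by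
  -- a uniform bound on the `(S+1)`-st derivative
  obtain ⟨D, hD⟩ := (hf.continuous_iteratedFDeriv (m := S + 1) (by exact_mod_cast le_top)
    ).bounded_above_of_compact_support (hsupp.iteratedFDeriv (S + 1))
  have hD0 : 0 ≤ D := (norm_nonneg _).trans (hD 0)
  -- the flat bound on every slice
  have hflat : ∀ t : ℝ, ∀ y : V, ‖f (t, y)‖ ≤ D * ‖y‖ ^ (S + 1) / S.factorial := by
    intro t y
    have hFt : ContDiff ℝ (S + 1 : ℕ) fun z : V ↦ f (t, z) :=
      (hf.of_le (by exact_mod_cast le_top)).comp (contDiff_const.prodMk contDiff_id)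
    refine norm_le_of_iteratedFDeriv_eq_zero hFt (hvan t) (fun z ↦ ?_) y
    exact (norm_iteratedFDeriv_slice_le hf t (by exact_mod_cast le_top) z).trans (hD _)
  -- the constant
  set I : ℝ := ∫ z : V, ‖z‖ ^ (2 * (S + 1)) * exp (-2 * ‖z‖ ^ 2) with hI
  have hI0 : 0 ≤ I := integral_nonneg fun z ↦ by positivity
  set K : ℝ := (D / S.factorial) ^ 2 with hK
  refine ⟨K * max T 0 * I, by positivity, fun lam hlam ↦ ?_⟩
  -- pointwise comparison with the Gaussian moment
  set G : V → ℝ := fun y ↦ ‖y‖ ^ (2 * (S + 1)) * exp (-2 * lam * ‖y‖ ^ 2) with hG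
  have hle : ∀ p : ℝ × V, ‖f p‖ ^ 2 * exp (-2 * lam * ‖p.2‖ ^ 2) ≤ K * G p.2 := by
    rintro ⟨t, y⟩
    have h1 := hflat t y
    have h0 : 0 ≤ ‖f (t, y)‖ := norm_nonneg _
    have h2 : ‖f (t, y)‖ ^ 2 ≤ (D * ‖y‖ ^ (S + 1) / S.factorial) ^ 2 :=
      pow_le_pow_left₀ h0 h1 2
    have h3 : (D * ‖y‖ ^ (S + 1) / S.factorial) ^ 2 = K * ‖y‖ ^ (2 * (S + 1)) := by
      rw [hK, pow_mul]; ring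
    calc ‖f (t, y)‖ ^ 2 * exp (-2 * lam * ‖y‖ ^ 2)
        ≤ K * ‖y‖ ^ (2 * (S + 1)) * exp (-2 * lam * ‖y‖ ^ 2) := by
          rw [← h3]; exact mul_le_mul_of_nonneg_right h2 (exp_pos _).le
      _ = K * G y := by simp only [hG]; ring
  -- integrability
  have hGint : Integrable G := by
    have h := integral_norm_pow_mul_exp_neg_mul_sq (V := V) (S + 1) hlam
    have hi := integrable_norm_pow_mul_exp_neg_two_mul_sq (V := V) (S + 1)
    -- `G` is a rescaled integrable function; prove integrability directly by domination
    have hg : Integrable fun z : V ↦ ((S + 1).factorial : ℝ) * (lam⁻¹) ^ (S + 1) *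
        exp (-lam * ‖z‖ ^ 2) := by
      have hc := (GaussianFourier.integrable_cexp_neg_mul_sq_norm_add (V := V) (b := lam)
        (by simpa using hlam) 0 0).norm
      have h' : (fun z : V ↦ ‖Complex.exp (-(lam : ℂ) * ‖z‖ ^ 2 + 0 * (inner ℝ (0 : V) z : ℂ))‖)
          = fun z : V ↦ exp (-lam * ‖z‖ ^ 2) := by
        funext z
        rw [Complex.norm_exp]
        simp [← Complex.ofReal_pow, ← Complex.ofReal_mul, ← Complex.ofReal_neg]
      rw [h'] at hc
      exact hc.const_mul _
    refine hg.mono' (by fun_prop) (Eventually.of_forall fun z ↦ ?_)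
    rw [Real.norm_eq_abs, abs_of_nonneg (by positivity)]
    have hx : 0 ≤ lam * ‖z‖ ^ 2 := by positivity
    have hb := pow_mul_exp_neg_le_factorial hx (S + 1)
    have hexp : exp (-2 * lam * ‖z‖ ^ 2) = exp (-(lam * ‖z‖ ^ 2)) * exp (-lam * ‖z‖ ^ 2) := by
      rw [← Real.exp_add]; ring_nf
    have hc : lam⁻¹ ^ (S + 1) * (lam * ‖z‖ ^ 2) ^ (S + 1) = (‖z‖ ^ 2) ^ (S + 1) := by
      rw [← mul_pow, ← mul_assoc, inv_mul_cancel₀ hlam.ne', one_mul]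
    have h1 : G z = (lam⁻¹) ^ (S + 1) * ((lam * ‖z‖ ^ 2) ^ (S + 1) * exp (-(lam * ‖z‖ ^ 2))) *
        exp (-lam * ‖z‖ ^ 2) := by
      simp only [hG]
      rw [hexp, pow_mul, show lam⁻¹ ^ (S + 1) * ((lam * ‖z‖ ^ 2) ^ (S + 1) *
        exp (-(lam * ‖z‖ ^ 2))) * exp (-lam * ‖z‖ ^ 2) = (lam⁻¹ ^ (S + 1) *
        (lam * ‖z‖ ^ 2) ^ (S + 1)) * (exp (-(lam * ‖z‖ ^ 2)) * exp (-lam * ‖z‖ ^ 2)) by ring, hc]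
    rw [h1]
    have hl0 : 0 ≤ (lam⁻¹) ^ (S + 1) := by positivity
    calc (lam⁻¹) ^ (S + 1) * ((lam * ‖z‖ ^ 2) ^ (S + 1) * exp (-(lam * ‖z‖ ^ 2))) *
        exp (-lam * ‖z‖ ^ 2)
        ≤ (lam⁻¹) ^ (S + 1) * ((S + 1).factorial : ℝ) * exp (-lam * ‖z‖ ^ 2) := by
          gcongr
      _ = ((S + 1).factorial : ℝ) * (lam⁻¹) ^ (S + 1) * exp (-lam * ‖z‖ ^ 2) := by ring
  have hLint : IntegrableOn (fun p : ℝ × V ↦ ‖f p‖ ^ 2 * exp (-2 * lam * ‖p.2‖ ^ 2))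
      (Icc (0 : ℝ) T ×ˢ (univ : Set V)) := by
    refine Continuous.integrable_of_hasCompactSupport ?_ ?_ |>.integrableOn
    · exact ((hf.continuous.norm).pow 2).mul (by fun_prop)
    · have : (fun p : ℝ × V ↦ ‖f p‖ ^ 2 * exp (-2 * lam * ‖p.2‖ ^ 2)) =
          fun p ↦ ‖f p‖ * (‖f p‖ * exp (-2 * lam * ‖p.2‖ ^ 2)) := by
        funext p; ring
      rw [this]
      exact hsupp.norm.mul_right
  have hRint : IntegrableOn (fun p : ℝ × V ↦ K * G p.2) (Icc (0 : ℝ) T ×ˢ (univ : Set V)) := by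
    have h1 : IntegrableOn (fun _ : ℝ ↦ K) (Icc (0 : ℝ) T) := integrableOn_const (by simp)
    have h2 : IntegrableOn G (univ : Set V) := hGint.integrableOn
    have := Integrable.mul_prod (μ := volume.restrict (Icc (0 : ℝ) T))
      (ν := volume.restrict (univ : Set V)) h1 h2
    rw [IntegrableOn, show (volume : Measure (ℝ × V)) =
      (volume : Measure ℝ).prod (volume : Measure V) from rfl, ← Measure.prod_restrict]
    exact this
  -- compare and compute
  calc ∫ p in Icc (0 : ℝ) T ×ˢ (univ : Set V), ‖f p‖ ^ 2 * exp (-2 * lam * ‖p.2‖ ^ 2)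
      ≤ ∫ p in Icc (0 : ℝ) T ×ˢ (univ : Set V), K * G p.2 :=
        setIntegral_mono_on hLint hRint (measurableSet_Icc.prod MeasurableSet.univ)
          fun p _ ↦ hle p
    _ = (∫ _t in Icc (0 : ℝ) T, K) * ∫ y in (univ : Set V), G y := by
        rw [← setIntegral_prod_mul (fun _ : ℝ ↦ K) G]; rfl
    _ = K * max T 0 * ((√lam)⁻¹ ^ (2 * (S + 1) + Module.finrank ℝ V) * I) := by
        rw [setIntegral_const, Measure.restrict_univ, Real.volume_real_Icc, sub_zero,
          smul_eq_mul, hI, ← integral_norm_pow_mul_exp_neg_mul_sq (S + 1) hlam]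
        ring
    _ = K * max T 0 * I * (√lam)⁻¹ ^ (2 * (S + 1) + Module.finrank ℝ V) := by ring

/-- The printed exponent: `(√λ)⁻¹^{2(S+1)+d} = λ^{-(S+1)-d/2}` for `λ > 0`. [folklore] -/
theorem inv_sqrt_pow_eq_rpow {lam : ℝ} (hlam : 0 < lam) (S d : ℕ) :
    (√lam)⁻¹ ^ (2 * (S + 1) + d) = lam ^ (-((S : ℝ) + 1) - (d : ℝ) / 2) := by
  rw [Real.sqrt_eq_rpow, ← Real.rpow_neg hlam.le, ← Real.rpow_natCast,
    ← Real.rpow_mul hlam.le]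
  congr 1
  push_cast
  ring

/-- **Sbierski's Gaussian damping lemma in the printed form** (`d = 3`, bound `C λ^{-(S+1)-3/2}`):
for `f ∈ C^∞_c(ℝ × ℝ³)` whose `y`-derivatives of order `≤ S` vanish on the axis `{y = 0}`,
`∫_{[0,T]×ℝ³} |f|² e^{-2λ|y|²} ≤ C λ^{-(S+1)-3/2}` for all `λ > 0`.
[cite: Sbierski2015, §3 (first lemma); arXiv:1311.2477 Lemma 4] -/
theorem gaussianDamping_three (f : ℝ × EuclideanSpace ℝ (Fin 3) → ℂ) (hf : ContDiff ℝ ∞ f)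
    (hsupp : HasCompactSupport f) (S : ℕ)
    (hvan : ∀ t : ℝ, ∀ k ≤ S,
      iteratedFDeriv ℝ k (fun y : EuclideanSpace ℝ (Fin 3) ↦ f (t, y)) 0 = 0) (T : ℝ) :
    ∃ C : ℝ, 0 ≤ C ∧ ∀ lam : ℝ, 0 < lam →
      ∫ p in Icc (0 : ℝ) T ×ˢ (univ : Set (EuclideanSpace ℝ (Fin 3))),
          ‖f p‖ ^ 2 * exp (-2 * lam * ‖p.2‖ ^ 2) ≤
        C * lam ^ (-((S : ℝ) + 1) - 3 / 2) := by
  obtain ⟨C, hC0, hC⟩ := gaussianDamping f hf hsupp S hvan T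
  refine ⟨C, hC0, fun lam hlam ↦ ?_⟩
  have h := hC lam hlam
  rw [finrank_euclideanSpace_fin, inv_sqrt_pow_eq_rpow hlam S 3] at h
  exact_mod_cast h

/-! ### The damping lemma along a moving centre `y = ξ(t)` -/

/-- The shear along `ξ` preserves Lebesgue measure on `ℝ × V` (Fubini and translation invariance
in the fibres). [folklore] -/
theorem measurePreserving_shear (ξ : ℝ → V) (hξ : Continuous ξ) :
    MeasurePreserving (fun p : ℝ × V ↦ (p.1, p.2 + ξ p.1)) (volume : Measure (ℝ × V))
      (volume : Measure (ℝ × V)) :=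
  (MeasurePreserving.id (volume : Measure ℝ)).skew_product (g := fun t v ↦ v + ξ t)
    (measurable_snd.add (hξ.measurable.comp measurable_fst))
    (Eventually.of_forall fun t ↦ map_add_right_eq_self volume (ξ t))

/-- **Gaussian damping along a moving centre**: for `f ∈ C^∞_c(ℝ × V)` whose transversal
derivatives of order `≤ S` vanish along the curve `{y = ξ(t)}` (`ξ` smooth) and `c > 0`,
`∫_{[0,T]×V} ‖f(t,y)‖² e^{-2λc‖y - ξ(t)‖²} ≤ C (√λ)⁻¹^{2(S+1)+d}` for all `λ > 0` — the form in
which the lemma is used for beams centred on a curve `s ↦ γ(s) = (s, ξ(s))` with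
`Im φ ≥ c · dist(·, γ)²` (Sbierski 2015, §3: the display `Im(φ)(x) ≥ c · (x₁² + x₂² + x₃²)` in
slice coordinates preceding the first lemma, and the proof of the second lemma). From `gaussianDamping` by the volume-preserving shear `(t, v) ↦ (t, v + ξ(t))`.
[cite: Sbierski2015, §3 (first lemma; second lemma, proof)] -/
theorem gaussianDamping_movingCenter (ξ : ℝ → V) (hξ : ContDiff ℝ ∞ ξ) (f : ℝ × V → E)
    (hf : ContDiff ℝ ∞ f) (hsupp : HasCompactSupport f) (S : ℕ)
    (hvan : ∀ t : ℝ, ∀ k ≤ S, iteratedFDeriv ℝ k (fun y : V ↦ f (t, y)) (ξ t) = 0) (T : ℝ)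
    {c : ℝ} (hc : 0 < c) :
    ∃ C : ℝ, 0 ≤ C ∧ ∀ lam : ℝ, 0 < lam →
      ∫ p in Icc (0 : ℝ) T ×ˢ (univ : Set V), ‖f p‖ ^ 2 * exp (-2 * lam * c * ‖p.2 - ξ p.1‖ ^ 2) ≤
        C * (√lam)⁻¹ ^ (2 * (S + 1) + Module.finrank ℝ V) := by
  -- the sheared function
  set g : ℝ × V → E := fun p ↦ f (p.1, p.2 + ξ p.1) with hg
  have hgdiff : ContDiff ℝ ∞ g :=
    hf.comp (contDiff_fst.prodMk (contDiff_snd.add (hξ.comp contDiff_fst)))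
  -- the shear `(t, v) ↦ (t, v + ξ(t))` as a homeomorphism of `ℝ × V`
  have hξc : Continuous ξ := hξ.continuous
  let Φ : ℝ × V ≃ₜ ℝ × V :=
    { toFun := fun p ↦ (p.1, p.2 + ξ p.1)
      invFun := fun p ↦ (p.1, p.2 - ξ p.1)
      left_inv := fun p ↦ by simp
      right_inv := fun p ↦ by simp
      continuous_toFun := continuous_fst.prodMk (continuous_snd.add (hξc.comp continuous_fst))
      continuous_invFun := continuous_fst.prodMk (continuous_snd.sub (hξc.comp continuous_fst)) }
  have hΦ : (Φ : ℝ × V → ℝ × V) = fun p ↦ (p.1, p.2 + ξ p.1) := rfl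
  have hgsupp : HasCompactSupport g := hsupp.comp_homeomorph Φ
  have hgvan : ∀ t : ℝ, ∀ k ≤ S, iteratedFDeriv ℝ k (fun y : V ↦ g (t, y)) 0 = 0 := by
    intro t k hk
    have h := iteratedFDeriv_comp_add_right (𝕜 := ℝ) (f := fun z : V ↦ f (t, z)) k (ξ t) (0 : V)
    simp only [zero_add] at h
    exact h.trans (hvan t k hk)
  obtain ⟨C, hC0, hC⟩ := gaussianDamping g hgdiff hgsupp S hgvan T
  set n : ℕ := 2 * (S + 1) + Module.finrank ℝ V with hn
  refine ⟨C * (√c)⁻¹ ^ n, by positivity, fun lam hlam ↦ ?_⟩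
  have hcl : 0 < c * lam := mul_pos hc hlam
  have h := hC (c * lam) hcl
  -- change of variables by the shear
  have hmp := measurePreserving_shear ξ hξc
  have hemb : MeasurableEmbedding fun p : ℝ × V ↦ (p.1, p.2 + ξ p.1) := by
    rw [← hΦ]; exact Φ.measurableEmbedding
  have hpre : (fun p : ℝ × V ↦ (p.1, p.2 + ξ p.1)) ⁻¹' (Icc (0 : ℝ) T ×ˢ (univ : Set V)) =
      Icc (0 : ℝ) T ×ˢ (univ : Set V) := by
    ext p; simp
  have hchange := hmp.setIntegral_preimage_emb hemb
    (fun q : ℝ × V ↦ ‖f q‖ ^ 2 * exp (-2 * lam * c * ‖q.2 - ξ q.1‖ ^ 2))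
    (Icc (0 : ℝ) T ×ˢ (univ : Set V))
  rw [hpre] at hchange
  rw [← hchange]
  have hint : (fun p : ℝ × V ↦ ‖f (p.1, p.2 + ξ p.1)‖ ^ 2 *
      exp (-2 * lam * c * ‖(p.1, p.2 + ξ p.1).2 - ξ (p.1, p.2 + ξ p.1).1‖ ^ 2)) =
      fun p ↦ ‖g p‖ ^ 2 * exp (-2 * (c * lam) * ‖p.2‖ ^ 2) := by
    funext p
    simp only [hg, add_sub_cancel_right]
    ring_nf
  rw [hint]
  refine h.trans (le_of_eq ?_)
  rw [Real.sqrt_mul hc.le, mul_inv, mul_pow]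
  ring

/-! ### Gaussian moments of every order, and slab integrals about a moving centre -/

/-- The Gaussian moment integrand `‖z‖^m e^{-2‖z‖²}` is integrable for every natural `m` (compare
with `1 + ‖z‖^{2m}`). [folklore] -/
theorem integrable_norm_pow_mul_exp_neg_two_mul_sq' (m : ℕ) :
    Integrable fun z : V ↦ ‖z‖ ^ m * exp (-2 * ‖z‖ ^ 2) := by
  have h0 := integrable_norm_pow_mul_exp_neg_two_mul_sq (V := V) 0
  have hm := integrable_norm_pow_mul_exp_neg_two_mul_sq (V := V) m
  simp only [mul_zero, pow_zero, one_mul] at h0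
  refine (h0.add hm).mono' (by fun_prop) (Eventually.of_forall fun z ↦ ?_)
  rw [Real.norm_eq_abs, abs_of_nonneg (by positivity)]
  have hz : ‖z‖ ^ m ≤ 1 + ‖z‖ ^ (2 * m) := by
    rcases le_or_gt ‖z‖ 1 with h | h
    · have : ‖z‖ ^ m ≤ 1 := pow_le_one₀ (norm_nonneg _) h
      linarith [pow_nonneg (norm_nonneg z) (2 * m)]
    · have : ‖z‖ ^ m ≤ ‖z‖ ^ (2 * m) := pow_le_pow_right₀ h.le (by omega)
      linarith
  calc ‖z‖ ^ m * exp (-2 * ‖z‖ ^ 2) ≤ (1 + ‖z‖ ^ (2 * m)) * exp (-2 * ‖z‖ ^ 2) := by gcongr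
    _ = exp (-2 * ‖z‖ ^ 2) + ‖z‖ ^ (2 * m) * exp (-2 * ‖z‖ ^ 2) := by ring

/-- **Scaling law of the Gaussian moments of every order**: for `λ > 0`,
`∫ ‖y‖^m e^{-2λ‖y‖²} dy = (√λ)⁻¹^{m + d} ∫ ‖z‖^m e^{-2‖z‖²} dz`, `d = dim V` (substitute
`y = z/√λ`; the case of even `m` is `integral_norm_pow_mul_exp_neg_mul_sq`).
[cite: Sbierski2015, §3 (first lemma, proof)] -/
theorem integral_norm_pow_mul_exp_neg_mul_sq' (m : ℕ) {lam : ℝ} (hlam : 0 < lam) :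
    ∫ y : V, ‖y‖ ^ m * exp (-2 * lam * ‖y‖ ^ 2) =
      (√lam)⁻¹ ^ (m + Module.finrank ℝ V) * ∫ z : V, ‖z‖ ^ m * exp (-2 * ‖z‖ ^ 2) := by
  set R : ℝ := (√lam)⁻¹ with hR
  have hRpos : 0 < R := by positivity
  have hR2 : lam * R ^ 2 = 1 := by
    rw [hR, inv_pow, Real.sq_sqrt hlam.le, mul_inv_cancel₀ hlam.ne']
  set G : V → ℝ := fun y ↦ ‖y‖ ^ m * exp (-2 * lam * ‖y‖ ^ 2) with hG
  have hcomp : ∀ z : V, G (R • z) = R ^ m * (‖z‖ ^ m * exp (-2 * ‖z‖ ^ 2)) := by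
    intro z
    simp only [hG, norm_smul, Real.norm_eq_abs, abs_of_pos hRpos, mul_pow]
    have : -2 * lam * (R ^ 2 * ‖z‖ ^ 2) = -2 * ‖z‖ ^ 2 := by
      rw [show -2 * lam * (R ^ 2 * ‖z‖ ^ 2) = -2 * (lam * R ^ 2) * ‖z‖ ^ 2 by ring, hR2]; ring
    rw [this]
    ring
  have hscale := Measure.integral_comp_smul (volume : Measure V) G R
  simp only [hcomp, integral_const_mul] at hscale
  have hRd : |(R ^ Module.finrank ℝ V)⁻¹| = (R ^ Module.finrank ℝ V)⁻¹ :=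
    abs_of_pos (by positivity)
  rw [hRd, smul_eq_mul] at hscale
  have hRdpos : 0 < R ^ Module.finrank ℝ V := by positivity
  have key : ∫ y : V, G y = R ^ Module.finrank ℝ V * (R ^ m *
      ∫ z : V, ‖z‖ ^ m * exp (-2 * ‖z‖ ^ 2)) := by
    rw [hscale, ← mul_assoc, mul_inv_cancel₀ hRdpos.ne', one_mul]
  show ∫ y : V, G y = _
  rw [key, pow_add]
  ring

/-- The Gaussian moments are non-negative. [folklore] -/
theorem integral_norm_pow_mul_exp_neg_two_mul_sq_nonneg (m : ℕ) :
    0 ≤ ∫ z : V, ‖z‖ ^ m * exp (-2 * ‖z‖ ^ 2) :=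
  integral_nonneg fun z ↦ by positivity

/-- **Slab integral of a Gaussian moment about a moving centre.** For `ξ : ℝ → V` continuous,
`m : ℕ`, `λ > 0` and any `T`,
`∫_{[0,T]×V} ‖y − ξ(t)‖^m e^{-2λ‖y − ξ(t)‖²} dt dy = max(T,0) · (√λ)⁻¹^{m+d} · ∫ ‖z‖^m e^{-2‖z‖²} dz`
(shear `(t, v) ↦ (t, v + ξ(t))`, Fubini, scaling). This is the size, in `L¹` of the slab, of the
model error terms `λ^j dist(·, γ)^m e^{-2λ Im φ}` of a Gaussian beam centred on the curve
`t ↦ (t, ξ(t))` (Sbierski 2015, §3, proofs of the first and second lemma, and §4, proof of the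
theorem: "stretched coordinates `y̲ = √λ x̲`"). [cite: Sbierski2015, §3 (first lemma, proof)] -/
theorem setIntegral_slab_norm_sub_pow_mul_exp (ξ : ℝ → V) (hξ : Continuous ξ) (m : ℕ) (T : ℝ)
    {lam : ℝ} (hlam : 0 < lam) :
    ∫ p in Icc (0 : ℝ) T ×ˢ (univ : Set V), ‖p.2 - ξ p.1‖ ^ m * exp (-2 * lam * ‖p.2 - ξ p.1‖ ^ 2) =
      max T 0 * ((√lam)⁻¹ ^ (m + Module.finrank ℝ V) * ∫ z : V, ‖z‖ ^ m * exp (-2 * ‖z‖ ^ 2)) := by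
  -- change of variables by the shear
  let Φ : ℝ × V ≃ₜ ℝ × V :=
    { toFun := fun p ↦ (p.1, p.2 + ξ p.1)
      invFun := fun p ↦ (p.1, p.2 - ξ p.1)
      left_inv := fun p ↦ by simp
      right_inv := fun p ↦ by simp
      continuous_toFun := continuous_fst.prodMk (continuous_snd.add (hξ.comp continuous_fst))
      continuous_invFun := continuous_fst.prodMk (continuous_snd.sub (hξ.comp continuous_fst)) }
  have hΦ : (Φ : ℝ × V → ℝ × V) = fun p ↦ (p.1, p.2 + ξ p.1) := rfl
  have hmp := measurePreserving_shear ξ hξ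
  have hemb : MeasurableEmbedding fun p : ℝ × V ↦ (p.1, p.2 + ξ p.1) := by
    rw [← hΦ]; exact Φ.measurableEmbedding
  have hpre : (fun p : ℝ × V ↦ (p.1, p.2 + ξ p.1)) ⁻¹' (Icc (0 : ℝ) T ×ˢ (univ : Set V)) =
      Icc (0 : ℝ) T ×ˢ (univ : Set V) := by
    ext p; simp
  have hchange := hmp.setIntegral_preimage_emb hemb
    (fun q : ℝ × V ↦ ‖q.2 - ξ q.1‖ ^ m * exp (-2 * lam * ‖q.2 - ξ q.1‖ ^ 2))
    (Icc (0 : ℝ) T ×ˢ (univ : Set V))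
  rw [hpre] at hchange
  rw [← hchange]
  simp only [add_sub_cancel_right]
  -- product integral
  set G : V → ℝ := fun y ↦ ‖y‖ ^ m * exp (-2 * lam * ‖y‖ ^ 2) with hG
  calc ∫ p in Icc (0 : ℝ) T ×ˢ (univ : Set V), ‖p.2‖ ^ m * exp (-2 * lam * ‖p.2‖ ^ 2)
      = ∫ p in Icc (0 : ℝ) T ×ˢ (univ : Set V), (fun _ : ℝ ↦ (1 : ℝ)) p.1 * G p.2 := by
        refine setIntegral_congr_fun (measurableSet_Icc.prod MeasurableSet.univ) fun p _ ↦ ?_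
        simp [hG]
    _ = (∫ _t in Icc (0 : ℝ) T, (1 : ℝ)) * ∫ y in (univ : Set V), G y := by
        rw [← setIntegral_prod_mul (fun _ : ℝ ↦ (1 : ℝ)) G]; rfl
    _ = max T 0 * ((√lam)⁻¹ ^ (m + Module.finrank ℝ V) *
          ∫ z : V, ‖z‖ ^ m * exp (-2 * ‖z‖ ^ 2)) := by
        rw [setIntegral_const, Measure.restrict_univ, Real.volume_real_Icc, sub_zero,
          smul_eq_mul, mul_one, hG, integral_norm_pow_mul_exp_neg_mul_sq' m hlam]

/-- **Slab bound for functions dominated by a Gaussian moment about a moving centre.** If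
`F ≤ D · ‖y − ξ(t)‖^m e^{-2λ‖y − ξ(t)‖²}` on `[0,T] × V` (`D ≥ 0`, `λ > 0`, `ξ` continuous), then
`∫_{[0,T]×V} F ≤ D · max(T,0) · (√λ)⁻¹^{m+d} · ∫ ‖z‖^m e^{-2‖z‖²} dz` — no regularity of `F` is
needed (a non-integrable `F` has integral `0`). The working form of Sbierski's damping estimates
for beams whose error terms are only known to be `O(λ^j dist(·, γ)^m e^{-λ c dist(·,γ)²})`.
[cite: Sbierski2015, §3 (first lemma, proof)] -/
theorem setIntegral_slab_le_of_le_norm_sub_pow_mul_exp (ξ : ℝ → V) (hξ : Continuous ξ)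
    {F : ℝ × V → ℝ} (m : ℕ) {D lam : ℝ} (hD : 0 ≤ D) (hlam : 0 < lam) (T : ℝ)
    (hF : ∀ p ∈ Icc (0 : ℝ) T ×ˢ (univ : Set V),
      F p ≤ D * (‖p.2 - ξ p.1‖ ^ m * exp (-2 * lam * ‖p.2 - ξ p.1‖ ^ 2))) :
    ∫ p in Icc (0 : ℝ) T ×ˢ (univ : Set V), F p ≤
      D * (max T 0 * ((√lam)⁻¹ ^ (m + Module.finrank ℝ V) *
        ∫ z : V, ‖z‖ ^ m * exp (-2 * ‖z‖ ^ 2))) := by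
  have hI := integral_norm_pow_mul_exp_neg_two_mul_sq_nonneg (V := V) m
  have hRHS : 0 ≤ D * (max T 0 * ((√lam)⁻¹ ^ (m + Module.finrank ℝ V) *
      ∫ z : V, ‖z‖ ^ m * exp (-2 * ‖z‖ ^ 2))) := by positivity
  by_cases hint : IntegrableOn F (Icc (0 : ℝ) T ×ˢ (univ : Set V))
  · -- the dominating function is integrable on the slab
    set G : ℝ × V → ℝ := fun p ↦ ‖p.2 - ξ p.1‖ ^ m * exp (-2 * lam * ‖p.2 - ξ p.1‖ ^ 2) with hG
    have hval := setIntegral_slab_norm_sub_pow_mul_exp ξ hξ m T hlam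
    have hGint : IntegrableOn G (Icc (0 : ℝ) T ×ˢ (univ : Set V)) := by
      -- `G` is the pull-back of the integrable product `1 ⊗ (moment)` by the inverse shear
      have hξn : Continuous fun t ↦ -ξ t := hξ.neg
      have hmp := measurePreserving_shear (fun t ↦ -ξ t) hξn
      let Φ : ℝ × V ≃ₜ ℝ × V :=
        { toFun := fun p ↦ (p.1, p.2 + -ξ p.1)
          invFun := fun p ↦ (p.1, p.2 - -ξ p.1)
          left_inv := fun p ↦ by simp
          right_inv := fun p ↦ by simp
          continuous_toFun := continuous_fst.prodMk (continuous_snd.add (hξn.comp continuous_fst))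
          continuous_invFun :=
            continuous_fst.prodMk (continuous_snd.sub (hξn.comp continuous_fst)) }
      have hΦ : (Φ : ℝ × V → ℝ × V) = fun p ↦ (p.1, p.2 + -ξ p.1) := rfl
      have hemb : MeasurableEmbedding fun p : ℝ × V ↦ (p.1, p.2 + -ξ p.1) := by
        rw [← hΦ]; exact Φ.measurableEmbedding
      have hpre : (fun p : ℝ × V ↦ (p.1, p.2 + -ξ p.1)) ⁻¹' (Icc (0 : ℝ) T ×ˢ (univ : Set V)) =
          Icc (0 : ℝ) T ×ˢ (univ : Set V) := by
        ext p; simp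
      have h0 : IntegrableOn (fun p : ℝ × V ↦ ‖p.2‖ ^ m * exp (-2 * lam * ‖p.2‖ ^ 2))
          (Icc (0 : ℝ) T ×ˢ (univ : Set V)) := by
        have h1 : IntegrableOn (fun _ : ℝ ↦ (1 : ℝ)) (Icc (0 : ℝ) T) := integrableOn_const (by simp)
        have h2 : Integrable fun y : V ↦ ‖y‖ ^ m * exp (-2 * lam * ‖y‖ ^ 2) := by
          -- rescale the `λ = 1` moment by `y ↦ √λ • y`
          have hne : (√lam : ℝ) ≠ 0 := (Real.sqrt_pos.2 hlam).ne'
          have hsc : Integrable fun y : V ↦ ‖(√lam : ℝ) • y‖ ^ m * exp (-2 * ‖(√lam : ℝ) • y‖ ^ 2) :=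
            (integrable_norm_pow_mul_exp_neg_two_mul_sq' (V := V) m).comp_smul hne
          have hfun : ∀ y : V, ‖(√lam : ℝ) • y‖ ^ m * exp (-2 * ‖(√lam : ℝ) • y‖ ^ 2) =
              (√lam) ^ m * (‖y‖ ^ m * exp (-2 * lam * ‖y‖ ^ 2)) := by
            intro y
            rw [norm_smul, Real.norm_eq_abs, abs_of_pos (Real.sqrt_pos.2 hlam), mul_pow,
              mul_pow, Real.sq_sqrt hlam.le]
            ring
          have h3 := (hsc.congr (Eventually.of_forall hfun)).const_mul ((√lam) ^ m)⁻¹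
          refine h3.congr (Eventually.of_forall fun y ↦ ?_)
          simp only
          rw [← mul_assoc, inv_mul_cancel₀ (pow_ne_zero _ hne), one_mul]
        have := Integrable.mul_prod (μ := volume.restrict (Icc (0 : ℝ) T))
          (ν := volume.restrict (univ : Set V)) h1 h2.integrableOn
        rw [IntegrableOn, show (volume : Measure (ℝ × V)) =
          (volume : Measure ℝ).prod (volume : Measure V) from rfl, ← Measure.prod_restrict]
        simpa using this
      have h := (hmp.integrableOn_comp_preimage hemb).2 h0
      rw [hpre] at h
      refine h.congr_fun (fun p _ ↦ ?_) (measurableSet_Icc.prod MeasurableSet.univ)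
      simp [hG, ← sub_eq_add_neg]
    calc ∫ p in Icc (0 : ℝ) T ×ˢ (univ : Set V), F p
        ≤ ∫ p in Icc (0 : ℝ) T ×ˢ (univ : Set V), D * G p :=
          setIntegral_mono_on hint (hGint.const_mul D) (measurableSet_Icc.prod MeasurableSet.univ)
            fun p hp ↦ hF p hp
      _ = D * (max T 0 * ((√lam)⁻¹ ^ (m + Module.finrank ℝ V) *
            ∫ z : V, ‖z‖ ^ m * exp (-2 * ‖z‖ ^ 2))) := by
          rw [integral_const_mul, hG, hval]
  · rw [integral_undef hint]
    exact hRHS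

omit [NormedSpace ℝ E] in
/-- **Gaussian damping from a flat bound, along a moving centre.** If
`‖f(t, y)‖ ≤ D ‖y − ξ(t)‖^{S+1}` for all `t, y` (`ξ` continuous; no regularity of `f` is needed)
then for every `c > 0` and `T`,
`∫_{[0,T]×V} ‖f(t,y)‖² e^{-2λc‖y − ξ(t)‖²} ≤ C (√λ)⁻¹^{2(S+1)+d}` for all `λ > 0`, with
`C = D² · max(T,0) · (√c)⁻¹^{2(S+1)+d} · ∫ ‖z‖^{2(S+1)} e^{-2‖z‖²} dz`. This is the form in which
the first lemma of §3 is *used* in the proofs of the second lemma and of the theorem of §4 (the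
flat bound `|f(x)| ≤ C |x̲|^{S+1}` is what the printed proof extracts from the vanishing of the
derivatives); `gaussianDamping_movingCenter` is the case of `f ∈ C^∞_c` with vanishing transversal
jets. [cite: Sbierski2015, §3 (first lemma and its proof)] -/
theorem gaussianDamping_of_norm_le (ξ : ℝ → V) (hξ : Continuous ξ) (f : ℝ × V → E) (S : ℕ)
    {D : ℝ} (hflat : ∀ t y, ‖f (t, y)‖ ≤ D * ‖y - ξ t‖ ^ (S + 1)) (T : ℝ) {c : ℝ} (hc : 0 < c) :
    ∃ C : ℝ, 0 ≤ C ∧ ∀ lam : ℝ, 0 < lam →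
      ∫ p in Icc (0 : ℝ) T ×ˢ (univ : Set V), ‖f p‖ ^ 2 * exp (-2 * lam * c * ‖p.2 - ξ p.1‖ ^ 2) ≤
        C * (√lam)⁻¹ ^ (2 * (S + 1) + Module.finrank ℝ V) := by
  set nn : ℕ := 2 * (S + 1) + Module.finrank ℝ V with hnn
  set I : ℝ := ∫ z : V, ‖z‖ ^ (2 * (S + 1)) * exp (-2 * ‖z‖ ^ 2) with hI
  have hI0 : 0 ≤ I := integral_norm_pow_mul_exp_neg_two_mul_sq_nonneg _
  refine ⟨D ^ 2 * max T 0 * (√c)⁻¹ ^ nn * I, by positivity, fun lam hlam ↦ ?_⟩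
  have hcl : 0 < c * lam := mul_pos hc hlam
  have hpt : ∀ p ∈ Icc (0 : ℝ) T ×ˢ (univ : Set V),
      ‖f p‖ ^ 2 * exp (-2 * lam * c * ‖p.2 - ξ p.1‖ ^ 2) ≤
        D ^ 2 * (‖p.2 - ξ p.1‖ ^ (2 * (S + 1)) * exp (-2 * (c * lam) * ‖p.2 - ξ p.1‖ ^ 2)) := by
    rintro ⟨t, y⟩ -
    have h1 := hflat t y
    have h0 : 0 ≤ ‖f (t, y)‖ := norm_nonneg _
    have h2 : ‖f (t, y)‖ ^ 2 ≤ (D * ‖y - ξ t‖ ^ (S + 1)) ^ 2 := pow_le_pow_left₀ h0 h1 2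
    have he : exp (-2 * lam * c * ‖y - ξ t‖ ^ 2) = exp (-2 * (c * lam) * ‖y - ξ t‖ ^ 2) := by
      congr 1; ring
    calc ‖f (t, y)‖ ^ 2 * exp (-2 * lam * c * ‖y - ξ t‖ ^ 2)
        ≤ (D * ‖y - ξ t‖ ^ (S + 1)) ^ 2 * exp (-2 * lam * c * ‖y - ξ t‖ ^ 2) :=
          mul_le_mul_of_nonneg_right h2 (exp_pos _).le
      _ = D ^ 2 * (‖y - ξ t‖ ^ (2 * (S + 1)) * exp (-2 * (c * lam) * ‖y - ξ t‖ ^ 2)) := by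
          rw [he, mul_pow, pow_mul]; ring
  refine (setIntegral_slab_le_of_le_norm_sub_pow_mul_exp ξ hξ (2 * (S + 1)) (sq_nonneg D) hcl T
    hpt).trans (le_of_eq ?_)
  rw [← hI, Real.sqrt_mul hc.le, mul_inv, mul_pow]
  ring


/-! ### The slab `L²` bound of `□u_λ` from the pointwise WKB bound (the first condition of the
proof of Thm. 2.1 for a beam), and the scaling lower bound behind `E^N_0(u_λ) ≥ C λ^{1/2}` -/

/-- **The model Gaussian moment about a moving centre is integrable on every slab**:
`(t, y) ↦ ‖y − ξ(t)‖^m e^{-2λ‖y − ξ(t)‖²}` is integrable on `[0,T] × V` (`ξ` continuous, `λ > 0`):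
it is the pull-back of the integrable product `1 ⊗ (‖·‖^m e^{-2λ‖·‖²})` by the volume-preserving
shear `(t, v) ↦ (t, v − ξ(t))`. [cite: Sbierski2015, §3 (first lemma, proof)] -/
theorem integrableOn_slab_norm_sub_pow_mul_exp (ξ : ℝ → V) (hξ : Continuous ξ) (m : ℕ) (T : ℝ)
    {lam : ℝ} (hlam : 0 < lam) :
    IntegrableOn (fun p : ℝ × V ↦ ‖p.2 - ξ p.1‖ ^ m * exp (-2 * lam * ‖p.2 - ξ p.1‖ ^ 2))
      (Icc (0 : ℝ) T ×ˢ (univ : Set V)) := by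
  have hξn : Continuous fun t ↦ -ξ t := hξ.neg
  have hmp := measurePreserving_shear (fun t ↦ -ξ t) hξn
  let Φ : ℝ × V ≃ₜ ℝ × V :=
    { toFun := fun p ↦ (p.1, p.2 + -ξ p.1)
      invFun := fun p ↦ (p.1, p.2 - -ξ p.1)
      left_inv := fun p ↦ by simp
      right_inv := fun p ↦ by simp
      continuous_toFun := continuous_fst.prodMk (continuous_snd.add (hξn.comp continuous_fst))
      continuous_invFun :=
        continuous_fst.prodMk (continuous_snd.sub (hξn.comp continuous_fst)) }
  have hΦ : (Φ : ℝ × V → ℝ × V) = fun p ↦ (p.1, p.2 + -ξ p.1) := rfl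
  have hemb : MeasurableEmbedding fun p : ℝ × V ↦ (p.1, p.2 + -ξ p.1) := by
    rw [← hΦ]; exact Φ.measurableEmbedding
  have hpre : (fun p : ℝ × V ↦ (p.1, p.2 + -ξ p.1)) ⁻¹' (Icc (0 : ℝ) T ×ˢ (univ : Set V)) =
      Icc (0 : ℝ) T ×ˢ (univ : Set V) := by
    ext p; simp
  have h0 : IntegrableOn (fun p : ℝ × V ↦ ‖p.2‖ ^ m * exp (-2 * lam * ‖p.2‖ ^ 2))
      (Icc (0 : ℝ) T ×ˢ (univ : Set V)) := by
    have h1 : IntegrableOn (fun _ : ℝ ↦ (1 : ℝ)) (Icc (0 : ℝ) T) := integrableOn_const (by simp)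
    have h2 : Integrable fun y : V ↦ ‖y‖ ^ m * exp (-2 * lam * ‖y‖ ^ 2) := by
      have hne : (√lam : ℝ) ≠ 0 := (Real.sqrt_pos.2 hlam).ne'
      have hsc : Integrable fun y : V ↦ ‖(√lam : ℝ) • y‖ ^ m * exp (-2 * ‖(√lam : ℝ) • y‖ ^ 2) :=
        (integrable_norm_pow_mul_exp_neg_two_mul_sq' (V := V) m).comp_smul hne
      have hfun : ∀ y : V, ‖(√lam : ℝ) • y‖ ^ m * exp (-2 * ‖(√lam : ℝ) • y‖ ^ 2) =
          (√lam) ^ m * (‖y‖ ^ m * exp (-2 * lam * ‖y‖ ^ 2)) := by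
        intro y
        rw [norm_smul, Real.norm_eq_abs, abs_of_pos (Real.sqrt_pos.2 hlam), mul_pow,
          mul_pow, Real.sq_sqrt hlam.le]
        ring
      have h3 := (hsc.congr (Eventually.of_forall hfun)).const_mul ((√lam) ^ m)⁻¹
      refine h3.congr (Eventually.of_forall fun y ↦ ?_)
      simp only
      rw [← mul_assoc, inv_mul_cancel₀ (pow_ne_zero _ hne), one_mul]
    have := Integrable.mul_prod (μ := volume.restrict (Icc (0 : ℝ) T))
      (ν := volume.restrict (univ : Set V)) h1 h2.integrableOn
    rw [IntegrableOn, show (volume : Measure (ℝ × V)) =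
      (volume : Measure ℝ).prod (volume : Measure V) from rfl, ← Measure.prod_restrict]
    simpa using this
  have h := (hmp.integrableOn_comp_preimage hemb).2 h0
  rw [hpre] at h
  refine h.congr_fun (fun p _ ↦ ?_) (measurableSet_Icc.prod MeasurableSet.univ)
  simp [← sub_eq_add_neg]

/-- **The first condition of the proof of Thm. 2.1 for a beam, from the pointwise WKB bound.**
Let `ξ : ℝ → V` be continuous, `c > 0`, `A, B, D, T ∈ ℝ`, `λ ≥ 1`, and let
`F : ℝ × V → ℝ` satisfy on the slab `[0,T] × V`
`|F(t, y)| ≤ e^{-λ c ‖y − ξ(t)‖²} (λ² A ‖y − ξ(t)‖³ + λ B ‖y − ξ(t)‖ + D)` — the shape of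
`□u_λ = e^{iλφ}(−λ² a (dφ·dφ) + iλ(2 grad φ(a) + a □φ) + □a)` for a beam centred on
`t ↦ (t, ξ(t))` with `Im φ ≥ c · dist²`, the eikonal term vanishing to second and the transport
term to zeroth order (Sbierski 2015, (2.9) and the second lemma of §3). Then
`∫_{[0,T]×V} F² ≤ 3 · max(T,0) · (A² (√c)⁻¹^{6+d} I₆ + B² (√c)⁻¹^{2+d} I₂ + D² (√c)⁻¹^d I₀) · λ (√λ)⁻¹^d`,
`I_m = ∫ ‖z‖^m e^{-2‖z‖²} dz`, `d = dim V`; for `d = 3` the right-hand side is `C λ^{-1/2} ≤ C`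
(no regularity of `F`: a non-integrable `F²` has integral `0`).
[cite: Sbierski2015, §3 (second lemma, proof of the first condition) with (2.9)] -/
theorem setIntegral_slab_sq_le_of_beam_bound (ξ : ℝ → V) (hξ : Continuous ξ) {A B D c : ℝ}
    (hc : 0 < c) (T : ℝ) {lam : ℝ} (hlam : 1 ≤ lam)
    {F : ℝ × V → ℝ}
    (hF : ∀ p ∈ Icc (0 : ℝ) T ×ˢ (univ : Set V),
      |F p| ≤ exp (-(lam * c * ‖p.2 - ξ p.1‖ ^ 2)) *
        (lam ^ 2 * A * ‖p.2 - ξ p.1‖ ^ 3 + lam * B * ‖p.2 - ξ p.1‖ + D)) :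
    ∫ p in Icc (0 : ℝ) T ×ˢ (univ : Set V), F p ^ 2 ≤
      3 * max T 0 *
        (A ^ 2 * ((√c)⁻¹ ^ (6 + Module.finrank ℝ V) * ∫ z : V, ‖z‖ ^ 6 * exp (-2 * ‖z‖ ^ 2)) +
          B ^ 2 * ((√c)⁻¹ ^ (2 + Module.finrank ℝ V) * ∫ z : V, ‖z‖ ^ 2 * exp (-2 * ‖z‖ ^ 2)) +
          D ^ 2 * ((√c)⁻¹ ^ Module.finrank ℝ V * ∫ z : V, ‖z‖ ^ 0 * exp (-2 * ‖z‖ ^ 2))) *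
        (lam * (√lam)⁻¹ ^ Module.finrank ℝ V) := by
  set d : ℕ := Module.finrank ℝ V with hd
  set I6 : ℝ := ∫ z : V, ‖z‖ ^ 6 * exp (-2 * ‖z‖ ^ 2) with hI6
  set I2 : ℝ := ∫ z : V, ‖z‖ ^ 2 * exp (-2 * ‖z‖ ^ 2) with hI2
  set I0 : ℝ := ∫ z : V, ‖z‖ ^ 0 * exp (-2 * ‖z‖ ^ 2) with hI0
  have hI6n : 0 ≤ I6 := integral_norm_pow_mul_exp_neg_two_mul_sq_nonneg _
  have hI2n : 0 ≤ I2 := integral_norm_pow_mul_exp_neg_two_mul_sq_nonneg _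
  have hI0n : 0 ≤ I0 := integral_norm_pow_mul_exp_neg_two_mul_sq_nonneg _
  have hlam0 : 0 < lam := one_pos.trans_le hlam
  have hcl : 0 < c * lam := mul_pos hc hlam0
  have hT : 0 ≤ max T 0 := le_max_right _ _
  have hsc : 0 ≤ (√c)⁻¹ := inv_nonneg.2 (Real.sqrt_nonneg _)
  -- the three model integrands
  set G : ℕ → ℝ × V → ℝ := fun m p ↦ ‖p.2 - ξ p.1‖ ^ m * exp (-2 * (c * lam) * ‖p.2 - ξ p.1‖ ^ 2)
    with hG
  have hGint : ∀ m, IntegrableOn (G m) (Icc (0 : ℝ) T ×ˢ (univ : Set V)) :=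
    fun m ↦ integrableOn_slab_norm_sub_pow_mul_exp ξ hξ m T hcl
  have hGval : ∀ m, ∫ p in Icc (0 : ℝ) T ×ˢ (univ : Set V), G m p =
      max T 0 * ((√(c * lam))⁻¹ ^ (m + d) * ∫ z : V, ‖z‖ ^ m * exp (-2 * ‖z‖ ^ 2)) :=
    fun m ↦ setIntegral_slab_norm_sub_pow_mul_exp ξ hξ m T hcl
  -- the pointwise bound for `F²`
  have hpt : ∀ p ∈ Icc (0 : ℝ) T ×ˢ (univ : Set V),
      F p ^ 2 ≤ 3 * (lam ^ 4 * A ^ 2) * G 6 p + 3 * (lam ^ 2 * B ^ 2) * G 2 p +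
        3 * D ^ 2 * G 0 p := by
    intro p hp
    have h := hF p hp
    set r : ℝ := ‖p.2 - ξ p.1‖ with hr
    have hr0 : 0 ≤ r := norm_nonneg _
    set e : ℝ := exp (-(lam * c * r ^ 2)) with he
    have he0 : 0 < e := exp_pos _
    have habs : 0 ≤ |F p| := abs_nonneg _
    have h2 : F p ^ 2 ≤ (e * (lam ^ 2 * A * r ^ 3 + lam * B * r + D)) ^ 2 := by
      rw [← sq_abs (F p)]
      exact pow_le_pow_left₀ habs h 2
    have h3 : (lam ^ 2 * A * r ^ 3 + lam * B * r + D) ^ 2 ≤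
        3 * ((lam ^ 2 * A * r ^ 3) ^ 2 + (lam * B * r) ^ 2 + D ^ 2) := by
      nlinarith [sq_nonneg (lam ^ 2 * A * r ^ 3 - lam * B * r), sq_nonneg (lam * B * r - D),
        sq_nonneg (lam ^ 2 * A * r ^ 3 - D)]
    have he2 : e ^ 2 = exp (-2 * (c * lam) * r ^ 2) := by
      rw [he, ← Real.exp_nat_mul]
      congr 1
      push_cast
      ring
    have hG6 : G 6 p = r ^ 6 * exp (-2 * (c * lam) * r ^ 2) := rfl
    have hG2 : G 2 p = r ^ 2 * exp (-2 * (c * lam) * r ^ 2) := rfl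
    have hG0 : G 0 p = r ^ 0 * exp (-2 * (c * lam) * r ^ 2) := rfl
    calc F p ^ 2 ≤ (e * (lam ^ 2 * A * r ^ 3 + lam * B * r + D)) ^ 2 := h2
      _ = e ^ 2 * (lam ^ 2 * A * r ^ 3 + lam * B * r + D) ^ 2 := by ring
      _ ≤ e ^ 2 * (3 * ((lam ^ 2 * A * r ^ 3) ^ 2 + (lam * B * r) ^ 2 + D ^ 2)) :=
          mul_le_mul_of_nonneg_left h3 (sq_nonneg _)
      _ = 3 * (lam ^ 4 * A ^ 2) * G 6 p + 3 * (lam ^ 2 * B ^ 2) * G 2 p +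
            3 * D ^ 2 * G 0 p := by
          rw [hG6, hG2, hG0, ← he2]; ring
  -- the right-hand side is nonnegative
  have hRHS : 0 ≤ 3 * max T 0 * (A ^ 2 * ((√c)⁻¹ ^ (6 + d) * I6) + B ^ 2 * ((√c)⁻¹ ^ (2 + d) * I2) +
      D ^ 2 * ((√c)⁻¹ ^ d * I0)) * (lam * (√lam)⁻¹ ^ d) := by positivity
  by_cases hint : IntegrableOn (fun p ↦ F p ^ 2) (Icc (0 : ℝ) T ×ˢ (univ : Set V))
  · have hdom : IntegrableOn (fun p ↦ 3 * (lam ^ 4 * A ^ 2) * G 6 p + 3 * (lam ^ 2 * B ^ 2) * G 2 p +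
        3 * D ^ 2 * G 0 p) (Icc (0 : ℝ) T ×ˢ (univ : Set V)) :=
      (((hGint 6).const_mul _).add ((hGint 2).const_mul _)).add ((hGint 0).const_mul _)
    have hstep : ∫ p in Icc (0 : ℝ) T ×ˢ (univ : Set V), F p ^ 2 ≤
        3 * (lam ^ 4 * A ^ 2) * (max T 0 * ((√(c * lam))⁻¹ ^ (6 + d) * I6)) +
          3 * (lam ^ 2 * B ^ 2) * (max T 0 * ((√(c * lam))⁻¹ ^ (2 + d) * I2)) +
          3 * D ^ 2 * (max T 0 * ((√(c * lam))⁻¹ ^ (0 + d) * I0)) := by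
      calc ∫ p in Icc (0 : ℝ) T ×ˢ (univ : Set V), F p ^ 2
          ≤ ∫ p in Icc (0 : ℝ) T ×ˢ (univ : Set V), (3 * (lam ^ 4 * A ^ 2) * G 6 p +
              3 * (lam ^ 2 * B ^ 2) * G 2 p + 3 * D ^ 2 * G 0 p) :=
            setIntegral_mono_on hint hdom (measurableSet_Icc.prod MeasurableSet.univ) hpt
        _ = 3 * (lam ^ 4 * A ^ 2) * (max T 0 * ((√(c * lam))⁻¹ ^ (6 + d) * I6)) +
              3 * (lam ^ 2 * B ^ 2) * (max T 0 * ((√(c * lam))⁻¹ ^ (2 + d) * I2)) +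
              3 * D ^ 2 * (max T 0 * ((√(c * lam))⁻¹ ^ (0 + d) * I0)) := by
            have h12 : IntegrableOn (fun p ↦ 3 * (lam ^ 4 * A ^ 2) * G 6 p +
                3 * (lam ^ 2 * B ^ 2) * G 2 p) (Icc (0 : ℝ) T ×ˢ (univ : Set V)) :=
              ((hGint 6).const_mul _).add ((hGint 2).const_mul _)
            rw [integral_add h12 ((hGint 0).const_mul _),
              integral_add ((hGint 6).const_mul _) ((hGint 2).const_mul _),
              integral_const_mul, integral_const_mul, integral_const_mul, hGval 6, hGval 2, hGval 0]
    refine hstep.trans ?_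
    -- algebra of the powers of `√(cλ)`
    have hlamne : lam ≠ 0 := hlam0.ne'
    have hsl0 : 0 < √lam := Real.sqrt_pos.2 hlam0
    set s : ℝ := (√lam)⁻¹ with hs
    have hs0 : 0 ≤ s := inv_nonneg.2 hsl0.le
    have hs2 : s ^ 2 = lam⁻¹ := by rw [hs, inv_pow, Real.sq_sqrt hlam0.le]
    have hsplit : ∀ m, (√(c * lam))⁻¹ ^ (m + d) = (√c)⁻¹ ^ (m + d) * (s ^ m * s ^ d) := by
      intro m
      rw [Real.sqrt_mul hc.le, mul_inv, mul_pow, ← pow_add]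
    have hs6 : s ^ 6 = lam⁻¹ ^ 3 := by rw [show (6 : ℕ) = 2 * 3 by norm_num, pow_mul, hs2]
    have h1 : lam ^ 4 * s ^ 6 = lam := by rw [hs6]; field_simp
    have h2 : lam ^ 2 * s ^ 2 = lam := by rw [hs2]; field_simp
    have h3 : s ^ d ≤ lam * s ^ d := le_mul_of_one_le_left (pow_nonneg hs0 _) hlam
    have hK0 : 0 ≤ 3 * D ^ 2 * (max T 0 * ((√c)⁻¹ ^ (0 + d) * I0)) := by positivity
    calc 3 * (lam ^ 4 * A ^ 2) * (max T 0 * ((√(c * lam))⁻¹ ^ (6 + d) * I6)) +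
          3 * (lam ^ 2 * B ^ 2) * (max T 0 * ((√(c * lam))⁻¹ ^ (2 + d) * I2)) +
          3 * D ^ 2 * (max T 0 * ((√(c * lam))⁻¹ ^ (0 + d) * I0))
        = 3 * A ^ 2 * (max T 0 * ((√c)⁻¹ ^ (6 + d) * I6)) * ((lam ^ 4 * s ^ 6) * s ^ d) +
          3 * B ^ 2 * (max T 0 * ((√c)⁻¹ ^ (2 + d) * I2)) * ((lam ^ 2 * s ^ 2) * s ^ d) +
          3 * D ^ 2 * (max T 0 * ((√c)⁻¹ ^ (0 + d) * I0)) * s ^ d := by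
          rw [hsplit 6, hsplit 2, hsplit 0, pow_zero, one_mul]; ring
      _ ≤ 3 * A ^ 2 * (max T 0 * ((√c)⁻¹ ^ (6 + d) * I6)) * (lam * s ^ d) +
          3 * B ^ 2 * (max T 0 * ((√c)⁻¹ ^ (2 + d) * I2)) * (lam * s ^ d) +
          3 * D ^ 2 * (max T 0 * ((√c)⁻¹ ^ (0 + d) * I0)) * (lam * s ^ d) := by
          rw [h1, h2]
          linarith [mul_le_mul_of_nonneg_left h3 hK0]
      _ = 3 * max T 0 * (A ^ 2 * ((√c)⁻¹ ^ (6 + d) * I6) + B ^ 2 * ((√c)⁻¹ ^ (2 + d) * I2) +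
          D ^ 2 * ((√c)⁻¹ ^ d * I0)) * (lam * (√lam)⁻¹ ^ d) := by
          rw [zero_add, hs]; ring
  · rw [integral_undef hint]
    exact hRHS

/-- **The first condition, qualitative form**: under the hypotheses of
`setIntegral_slab_sq_le_of_beam_bound` there is `C ≥ 0`, depending only on `A, B, D, c, T` and
`dim V`, with `∫_{[0,T]×V} F² ≤ C λ (√λ)⁻¹^d` for every `λ ≥ 1` and every `F` obeying the
pointwise beam bound with parameter `λ`; for `d = dim V ≥ 2` in particular `≤ C`
(`‖□u_λ‖_{L²(R_{[0,T]})} ≤ C(T)`, the first of the three conditions of the proof of Thm. 2.1).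
[cite: Sbierski2015, §3 (second lemma) and §2 (proof of Thm. 2.1, first condition)] -/
theorem exists_slab_sq_le_of_beam_bound (ξ : ℝ → V) (hξ : Continuous ξ) (A B D : ℝ) {c : ℝ}
    (hc : 0 < c) (T : ℝ) :
    ∃ C : ℝ, 0 ≤ C ∧ ∀ lam : ℝ, 1 ≤ lam → ∀ F : ℝ × V → ℝ,
      (∀ p ∈ Icc (0 : ℝ) T ×ˢ (univ : Set V),
        |F p| ≤ exp (-(lam * c * ‖p.2 - ξ p.1‖ ^ 2)) *
          (lam ^ 2 * A * ‖p.2 - ξ p.1‖ ^ 3 + lam * B * ‖p.2 - ξ p.1‖ + D)) →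
      (∫ p in Icc (0 : ℝ) T ×ˢ (univ : Set V), F p ^ 2 ≤
          C * (lam * (√lam)⁻¹ ^ Module.finrank ℝ V)) ∧
      (2 ≤ Module.finrank ℝ V → ∫ p in Icc (0 : ℝ) T ×ˢ (univ : Set V), F p ^ 2 ≤ C) := by
  have hI6n := integral_norm_pow_mul_exp_neg_two_mul_sq_nonneg (V := V) 6
  have hI2n := integral_norm_pow_mul_exp_neg_two_mul_sq_nonneg (V := V) 2
  have hI0n := integral_norm_pow_mul_exp_neg_two_mul_sq_nonneg (V := V) 0
  have hsc : 0 ≤ (√c)⁻¹ := inv_nonneg.2 (Real.sqrt_nonneg _)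
  refine ⟨3 * max T 0 *
      (A ^ 2 * ((√c)⁻¹ ^ (6 + Module.finrank ℝ V) * ∫ z : V, ‖z‖ ^ 6 * exp (-2 * ‖z‖ ^ 2)) +
        B ^ 2 * ((√c)⁻¹ ^ (2 + Module.finrank ℝ V) * ∫ z : V, ‖z‖ ^ 2 * exp (-2 * ‖z‖ ^ 2)) +
        D ^ 2 * ((√c)⁻¹ ^ Module.finrank ℝ V * ∫ z : V, ‖z‖ ^ 0 * exp (-2 * ‖z‖ ^ 2))),
    by positivity, fun lam hlam F hF ↦ ?_⟩
  have hmain := setIntegral_slab_sq_le_of_beam_bound ξ hξ hc T hlam hF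
  refine ⟨hmain, fun hd ↦ hmain.trans ?_⟩
  -- `λ (√λ)⁻¹^d ≤ 1` for `λ ≥ 1`, `d ≥ 2`
  have hlam0 : 0 < lam := one_pos.trans_le hlam
  have hsl1 : 1 ≤ √lam := by rw [← Real.sqrt_one]; exact Real.sqrt_le_sqrt hlam
  have hsl0 : 0 < √lam := one_pos.trans_le hsl1
  have hs1 : (√lam)⁻¹ ≤ 1 := inv_le_one_of_one_le₀ hsl1
  have hs0 : 0 ≤ (√lam)⁻¹ := inv_nonneg.2 hsl0.le
  obtain ⟨k, hk⟩ := Nat.exists_eq_add_of_le hd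
  have hle : lam * (√lam)⁻¹ ^ Module.finrank ℝ V ≤ 1 := by
    rw [hk, pow_add, inv_pow, Real.sq_sqrt hlam0.le, ← mul_assoc, mul_inv_cancel₀ hlam0.ne',
      one_mul]
    exact pow_le_one₀ hs0 hs1
  have hC0 : 0 ≤ 3 * max T 0 *
      (A ^ 2 * ((√c)⁻¹ ^ (6 + Module.finrank ℝ V) * ∫ z : V, ‖z‖ ^ 6 * exp (-2 * ‖z‖ ^ 2)) +
        B ^ 2 * ((√c)⁻¹ ^ (2 + Module.finrank ℝ V) * ∫ z : V, ‖z‖ ^ 2 * exp (-2 * ‖z‖ ^ 2)) +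
        D ^ 2 * ((√c)⁻¹ ^ Module.finrank ℝ V * ∫ z : V, ‖z‖ ^ 0 * exp (-2 * ‖z‖ ^ 2))) := by
    positivity
  exact mul_le_of_le_one_right hC0 hle

open scoped Pointwise in
/-- **The scaling lower bound behind `E^N_0(u_λ) ≥ C λ^{1/2}`** (proof of the second lemma of §3:
"the term `e^{-2λ Im φ}` leads to a `λ^{-3/2}` damping — and only to a `λ^{-3/2}` damping"): for
`C ∈ ℝ`, `δ > 0`, `λ ≥ 1` and any centre `y₀`,
`(√λ)⁻¹^d ∫_{B(0,δ)} e^{-2C‖z‖²} dz ≤ ∫_{B(y₀,δ)} e^{-2λC‖y − y₀‖²} dy`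
(translate to `y₀ = 0`, substitute `z = √λ y`, and shrink the ball `B(0, √λ δ) ⊇ B(0, δ)`).
[cite: Sbierski2015, §3 (second lemma, proof: lower bound for the initial energy)] -/
theorem le_setIntegral_ball_exp_neg_mul_sq (C : ℝ) {δ lam : ℝ} (hδ : 0 < δ) (hlam : 1 ≤ lam)
    (y₀ : V) :
    (√lam)⁻¹ ^ Module.finrank ℝ V * ∫ z in Metric.ball (0 : V) δ, exp (-2 * C * ‖z‖ ^ 2) ≤
      ∫ y in Metric.ball y₀ δ, exp (-2 * lam * C * ‖y - y₀‖ ^ 2) := by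
  have hlam0 : 0 < lam := one_pos.trans_le hlam
  have hsl1 : 1 ≤ √lam := by rw [← Real.sqrt_one]; exact Real.sqrt_le_sqrt hlam
  have hsl0 : 0 < √lam := one_pos.trans_le hsl1
  -- translate the ball to the origin
  have htrans : ∫ y in Metric.ball y₀ δ, exp (-2 * lam * C * ‖y - y₀‖ ^ 2) =
      ∫ z in Metric.ball (0 : V) δ, exp (-2 * lam * C * ‖z‖ ^ 2) := by
    have hmp : MeasurePreserving (fun z : V ↦ z + y₀) volume volume :=
      measurePreserving_add_right volume y₀
    have hpre : (fun z : V ↦ z + y₀) ⁻¹' Metric.ball y₀ δ = Metric.ball (0 : V) δ := by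
      ext z; simp [Metric.mem_ball, dist_eq_norm]
    have h := hmp.setIntegral_preimage_emb (measurableEmbedding_addRight y₀)
      (fun y ↦ exp (-2 * lam * C * ‖y - y₀‖ ^ 2)) (Metric.ball y₀ δ)
    rw [hpre] at h
    rw [← h]
    simp
  rw [htrans]
  -- substitute `z = √λ • y`
  set g : V → ℝ := fun w ↦ exp (-2 * C * ‖w‖ ^ 2) with hg
  have hcomp : ∀ z : V, exp (-2 * lam * C * ‖z‖ ^ 2) = g ((√lam : ℝ) • z) := by
    intro z
    simp only [hg, norm_smul, Real.norm_eq_abs, abs_of_pos hsl0, mul_pow, Real.sq_sqrt hlam0.le]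
    congr 1; ring
  have hscale := Measure.setIntegral_comp_smul_of_pos volume g (Metric.ball (0 : V) δ) hsl0
  have hball : (√lam : ℝ) • Metric.ball (0 : V) δ = Metric.ball (0 : V) (√lam * δ) := by
    rw [smul_ball hsl0.ne', smul_zero, Real.norm_eq_abs, abs_of_pos hsl0]
  simp_rw [hcomp]
  rw [hscale, hball, smul_eq_mul, inv_pow]
  refine mul_le_mul_of_nonneg_left ?_ (inv_nonneg.2 (pow_nonneg hsl0.le _))
  -- shrink the ball
  have hgint : IntegrableOn g (Metric.ball (0 : V) (√lam * δ)) := by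
    have hcont : Continuous g := by rw [hg]; fun_prop
    exact (hcont.continuousOn.integrableOn_compact
      (isCompact_closedBall (0 : V) (√lam * δ))).mono_set Metric.ball_subset_closedBall
  exact setIntegral_mono_set hgint (Eventually.of_forall fun z ↦ (exp_pos _).le)
    (Metric.ball_subset_ball (le_mul_of_one_le_left hδ.le hsl1)).eventuallyLE

end Literature.Analysis.Asymptotics.GaussianBeam
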